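import Summits.QuantumFields.BalabanUV.Beta.GAN24.CoarseGaugeSourceResponse
import Summits.QuantumFields.BalabanUV.Beta.GAN24.MultiplierVertexBondSum
import Summits.QuantumFields.BalabanUV.Beta.CombChartHColumnWard
import Summits.QuantumFields.BalabanUV.Beta.CombChartWardSockets

/-!
# `BalabanUV.Beta.GAN24.ColumnResponseOfWardLetters` — binder row G-an2-4 ∕ (CONV-C), TRANSFER-III («slot the chain», the OWNER gan24-p1's
# `TRANSFER-III-SIZING.v0_7.md` §3(a), second option; R-gan24p1-g46-2): **THE SINGLE-COORDINATE COLUMN RESPONSES OF A PACKED KERNEL FROM ITS TWO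
# COLUMN WARD LETTERS ALONE** — road-P2 g41's `CoarseGaugeSourceResponse` §2–§4 RE-CUT OVER A GENERIC KERNEL `X` WITH DISPLAYED LETTERS, and the
# instance at the COMB-CHART resolvents `G′_j = GcombSh Lc j` of row D1's literal of record (III′)
# (G-an2-4 CRUX TEAM (2), leaf prover `b2b-balaban-gan24-formalise-leaf-02`, gen 78)

NOT IN PRINT; OUR BOOKKEEPING ([folklore] `tsum` bookkeeping BY NAME over road-P2 g41's generic §1 (`summable_bdd_mul`, `tsum_mul_coarseDiv_eq`,
`tsum_mul_gaugeWt`, `blk_add_unitVec_apply`, `tsum_coord_fibre`), gan24-leaf-14's `MultiplierVertexBondSum.summable_exp_coarse ∕ abs_colM_le_fine`, and — for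
the instance — an2's (III′) letters `CombChartHColumnWard.colH_ward_GcombSh`, `CombChartWardSockets.colM_GcombSh_ward`, `CombChartStepJets.decays_GcombSh`;
0 `def`, 0 cited fact, 0 `def … : Prop`, 0 sorry).
HONEST FRAMING (cell contract, verbatim): «discharging `BetaPertH` makes Bałaban's UV stability UNCONDITIONAL — a real constructive-QFT result; it is NOT the
continuum limit and NOT the Clay problem.»  HONEST DEPENDENCY (verbatim): «continuum YM on T⁴ ⇐ BetaPertH ∧ nine spine estimates (0/9 proved); BetaPertH ⇐
(D1) ∧ (D4) ∧ CAP+tail; G-an2-4 gates asym, D1 and NE2/3/4.»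

WHY.  Road-P2's `CoarseGaugeSourceResponse` (the (S) row ∕ (W-γ) of the (α-0) chain: «a multiplier source depending on one coordinate is answered on the
exit bonds of its slabs only, and not at all on the multiplier legs») is stated for the chart-(II)∕(E) resolvent `G_j = coDressKBmAt ρ Lc (KInvStep Lc j)`;
its proof reads `G_j` through exactly two letters — d1-leaf-07's `ℋ`-column Ward law `colH_ward_KInvStep_all` and an1's multiplier-column Ward law
`colM_coDressKBmAt_KInvStep_ward` — plus the summability of the source series.  The literal OF RECORD (III′) `JsB12CombShSym` runs the SAME slotted
constructors at the comb-chart resolvents `G′_j = GcombSh Lc j = coDressKAt ρ_c Lc (Gsym Lc j)` (`CombChartStepJets`), for which an2 typed both letters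
with the SAME constant `cH_j = (stepScale d Lc j · Lc^{d+1})⁻¹` (`colH_ward_GcombSh`, `colM_GcombSh_ward`).  This file states the responses ONCE over the
letters, so that (E) (road-P2's file, not restated) and (III′) (§4) are instances.

WHAT (generic `d`, blocking `Lc ≥ 1`, a packed kernel `X : MKer (d+1) (Fib d)`, a real constant `cH`):
* §1 `summable_colH_of_decays`, `summable_colM_of_decays` — the source series of the `ℋ`- and multiplier columns of a kernel with `Decays X C m`, `m > 0`, are summable.
* §2 THE LETTERS (displayed hypotheses): (S-H) `∀ μ κ u, Summable (y ↦ colH X Lc μ y κ u)`, (W-H) `∀ y κ u, Σ_μ (colH X Lc μ (y − e_μ) κ u − colH X Lc μ y κ u) = cH·gaugeWt Lc y κ u`,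
  (S-M) `∀ μ ρ w, Summable (y ↦ colM X Lc μ y ρ w)`, (W-M) `∀ y ρ w, Σ_μ (colM X Lc μ (y − e_μ) ρ w − colM X Lc μ y ρ w) = 0`.  Under them, VERBATIM twins of road-P2's §2–§4:
  **`sum_tsum_coarseGrad_colH_of_ward`** (`Σ_μ Σ'_y (φ(y+e_μ) − φ(y))·colH X Lc μ y κ u = cH·(φ(blk Lc (u+e_κ)) − φ(blk Lc u))`, bounded `φ`), `sum_tsum_coarseGrad_colM_of_ward` (`= 0`),
  `tsum_coordGrad_colH_of_ward`, **`tsum_slab_colH_of_ward`** (`Σ'_y 𝟙[y_a = t]·colH X Lc a y κ u = cH·𝟙[κ = a ∧ u_a % Lc = Lc−1 ∧ (blk u)_a = t]`), `tsum_slab_colM_of_ward` (`= 0`),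
  **`tsum_coord_colH_of_ward`** (`Σ'_y f(y_a)·colH X Lc a y κ u = cH·𝟙[κ = a ∧ u_a % Lc = Lc−1]·f((blk u)_a)`, bounded `f : ℤ → ℝ`), **`tsum_coord_colM_of_ward`** (`= 0`), `hasSum_coord_colM_of_ward`.
* §3 THE LETTERS PASS TO THE UNITS-RESCALED KERNEL `unitK s_f s_m X` (the dressed steps `X̃` of the chain): `colH_ward_unitK` (constant `s_f·s_m·cH`), `colM_ward_unitK` (`0`),
  `shiftK_unitK_of_shiftK` ((TG)).
* §4 THE (III′) INSTANCE `X := GcombSh Lc j` (every `j`; letters BY NAME): `summable_source_colH_GcombSh`, `summable_source_colM_GcombSh`, **`tsum_coord_colH_GcombSh`**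
  (constant `cH_j`), `tsum_slab_colH_GcombSh`, **`tsum_coord_colM_GcombSh`**, `hasSum_coord_colM_GcombSh`.
Asserts NO value of any table; a statement about typed resolvents only; discharges NOTHING of (S) ∕ (W-γ) ∕ (C) ∕ (C)sym ∕ (Q-L) ∕ the S-slot `(hS, hSall)` ∕ the W-slot
`(hW, hWall)` at (E) or (III′); NEVER «G-an2-4 closed» as (CONV-C); NOT D1, NOT `BetaPertH`, NOT continuum, NOT Clay.  2026-08-25; no existing file touched.
-/

noncomputable section

open Finset
open scoped BigOperators
open Literature.MathematicalPhysics.QuantumFieldTheory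
open Literature.MathematicalPhysics.QuantumFieldTheory.Balaban1983to89
open Literature.MathematicalPhysics.QuantumFieldTheory.Balaban1983to89.Beta
open B12Sec2to5 (l1)
open B6BondElimination (unitVec unitVec_apply)
open ExpKernelCalculus (Site MKer Decays shiftK summable_exp_shift)
open AveragingContours (blk)
open OneStepResolventKernel (Fib)
open OneStepKernelFamily (colH abs_colH_le)
open SecondOrderResponse (colM)
open Summit.QuantumFields.BalabanUV.Beta.BorderedHessian (stepScale)
open Summit.QuantumFields.BalabanUV.Beta.KernelWardRelative (gaugeWt)
open Summit.QuantumFields.BalabanUV.Beta.HessKerDressedUnits (unitK colH_unitK)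
open Summit.QuantumFields.BalabanUV.Beta.GAN24.MultiplierZeroMass (colM_unitK)
open Summit.QuantumFields.BalabanUV.Beta.GAN24.CoarseGaugeSourceResponse (summable_bdd_mul tsum_mul_coarseDiv_eq tsum_mul_gaugeWt
  blk_add_unitVec_apply tsum_coord_fibre)
open Summit.QuantumFields.BalabanUV.Beta.GAN24.MultiplierVertexBondSum (summable_exp_coarse abs_colM_le_fine)
open Summit.QuantumFields.BalabanUV.Beta.CombChartStepJets (GcombSh decays_GcombSh)
open Summit.QuantumFields.BalabanUV.Beta.CombChartHColumnWard (colH_ward_GcombSh)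
open Summit.QuantumFields.BalabanUV.Beta.CombChartWardSockets (colM_GcombSh_ward)

namespace Summit.QuantumFields.BalabanUV.Beta.GAN24.ColumnResponseOfWardLetters

variable {d : ℕ} {Lc : ℕ}

/-! ## §1 The source series of the columns of a decaying kernel are summable -/

/-- [folklore] **SUMMABLE `ℋ`-COLUMN SOURCE SERIES**: for `Decays X C m` (`m > 0`) and every fine field leg `(κ, u)`, `y ↦ colH X Lc μ y κ u` is summable
(`|colH X Lc μ y κ u| ≤ C·e^{−m|u − Lc•y|₁}`, a subseries of the lattice exponential). -/
theorem summable_colH_of_decays [NeZero Lc] {X : MKer (d + 1) (Fib d)} {C m : ℝ} (hX : Decays X C m) (hm : 0 < m) (μ κ : Fin (d + 1)) (u : Site (d + 1)) :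
    Summable fun y : Site (d + 1) => colH X Lc μ y κ u := by
  refine Summable.of_norm_bounded (g := fun y : Site (d + 1) => C * Real.exp (-m * l1 (u - (Lc : ℤ) • y)))
    ((summable_exp_coarse (N := Lc) hm u).mul_left C) fun y => ?_
  rw [Real.norm_eq_abs]
  exact abs_colH_le hX μ y κ u

/-- [folklore] **SUMMABLE MULTIPLIER-COLUMN SOURCE SERIES**: for `Decays X C m` (`m > 0`) and every coarse multiplier leg `(ρ, w)`, `y ↦ colM X Lc μ y ρ w` is summable
(`|colM X Lc μ y ρ w| ≤ C·e^{−m|w − y|₁}`, gan24-leaf-14's fine-units bound). -/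
theorem summable_colM_of_decays [NeZero Lc] {X : MKer (d + 1) (Fib d)} {C m : ℝ} (hX : Decays X C m) (hm : 0 < m) (μ ρ : Fin (d + 1)) (w : Site (d + 1)) :
    Summable fun y : Site (d + 1) => colM X Lc μ y ρ w := by
  refine Summable.of_norm_bounded (g := fun y : Site (d + 1) => C * Real.exp (-m * l1 (w - y)))
    ((summable_exp_shift hm w).mul_left C) fun y => ?_
  rw [Real.norm_eq_abs]
  exact abs_colM_le_fine hX hm.le μ y ρ w

/-! ## §2 The responses from the two column Ward letters -/

section Ward

variable {X : MKer (d + 1) (Fib d)} {cH : ℝ}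

/-- NOT IN PRINT; OUR BOOKKEEPING.  **THE RESPONSE TO A COARSE PURE-GAUGE SOURCE IS THE FINE PURE GAUGE OF ITS BLOCK LIFT, FROM THE `ℋ`-COLUMN WARD LETTER**
(bounded `φ : Site → ℝ`, every fine field leg `(κ,u)`): `Σ_μ Σ'_y (φ(y + e_μ) − φ(y))·colH X Lc μ y κ u = cH·(φ(blk Lc (u + e_κ)) − φ(blk Lc u))` — summation by parts on
the source index (road-P2's `tsum_mul_coarseDiv_eq`), the letter (W-H), the two one-point sums of `gaugeWt`. -/
theorem sum_tsum_coarseGrad_colH_of_ward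
    (hHs : ∀ (μ κ : Fin (d + 1)) (u : Site (d + 1)), Summable fun y : Site (d + 1) => colH X Lc μ y κ u)
    (hHw : ∀ (y : Site (d + 1)) (κ : Fin (d + 1)) (u : Site (d + 1)),
      ∑ μ, (colH X Lc μ (y - unitVec μ) κ u - colH X Lc μ y κ u) = cH * gaugeWt Lc y κ u)
    (φ : Site (d + 1) → ℝ) {B : ℝ} (hφ : ∀ y, |φ y| ≤ B) (κ : Fin (d + 1)) (u : Site (d + 1)) :
    ∑ μ, ∑' y : Site (d + 1), (φ (y + unitVec μ) - φ y) * colH X Lc μ y κ u = cH * (φ (blk Lc (u + unitVec κ)) - φ (blk Lc u)) := by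
  rw [← tsum_mul_coarseDiv_eq (fun μ y => colH X Lc μ y κ u) (fun μ => hHs μ κ u) φ hφ]
  have e : ∀ y : Site (d + 1), φ y * ∑ μ, (colH X Lc μ (y - unitVec μ) κ u - colH X Lc μ y κ u) = cH * (φ y * gaugeWt Lc y κ u) :=
    fun y => by rw [hHw y κ u]; ring
  rw [tsum_congr e, tsum_mul_left, tsum_mul_gaugeWt]

/-- NOT IN PRINT; OUR BOOKKEEPING.  **THE SAME RESPONSE HAS NO MULTIPLIER LEGS, FROM THE MULTIPLIER-COLUMN WARD LETTER**:
`Σ_μ Σ'_y (φ(y + e_μ) − φ(y))·colM X Lc μ y ρ w = 0` (bounded `φ`). -/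
theorem sum_tsum_coarseGrad_colM_of_ward
    (hMs : ∀ (μ ρ : Fin (d + 1)) (w : Site (d + 1)), Summable fun y : Site (d + 1) => colM X Lc μ y ρ w)
    (hMw : ∀ (y : Site (d + 1)) (ρ : Fin (d + 1)) (w : Site (d + 1)), ∑ μ, (colM X Lc μ (y - unitVec μ) ρ w - colM X Lc μ y ρ w) = 0)
    (φ : Site (d + 1) → ℝ) {B : ℝ} (hφ : ∀ y, |φ y| ≤ B) (ρ : Fin (d + 1)) (w : Site (d + 1)) :
    ∑ μ, ∑' y : Site (d + 1), (φ (y + unitVec μ) - φ y) * colM X Lc μ y ρ w = 0 := by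
  rw [← tsum_mul_coarseDiv_eq (fun μ y => colM X Lc μ y ρ w) (fun μ => hMs μ ρ w) φ hφ]
  have e : ∀ y : Site (d + 1), φ y * ∑ μ, (colM X Lc μ (y - unitVec μ) ρ w - colM X Lc μ y ρ w) = 0 := fun y => by
    rw [hMw y ρ w, mul_zero]
  rw [tsum_congr e, tsum_zero]

/-- NOT IN PRINT; OUR BOOKKEEPING.  **A COARSE SOURCE DEPENDING ON ONE COORDINATE IS ANSWERED ON EXIT BONDS ONLY** (direction `a`, bounded `Φ : ℤ → ℝ`):
`Σ'_y (Φ(y_a + 1) − Φ(y_a))·colH X Lc a y κ u = cH·𝟙[κ = a ∧ u_a % Lc = Lc − 1]·(Φ((blk u)_a + 1) − Φ((blk u)_a))`. -/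
theorem tsum_coordGrad_colH_of_ward [NeZero Lc]
    (hHs : ∀ (μ κ : Fin (d + 1)) (u : Site (d + 1)), Summable fun y : Site (d + 1) => colH X Lc μ y κ u)
    (hHw : ∀ (y : Site (d + 1)) (κ : Fin (d + 1)) (u : Site (d + 1)),
      ∑ μ, (colH X Lc μ (y - unitVec μ) κ u - colH X Lc μ y κ u) = cH * gaugeWt Lc y κ u)
    (a : Fin (d + 1)) (Φ : ℤ → ℝ) {B : ℝ} (hΦ : ∀ s, |Φ s| ≤ B) (κ : Fin (d + 1)) (u : Site (d + 1)) :
    ∑' y : Site (d + 1), (Φ (y a + 1) - Φ (y a)) * colH X Lc a y κ u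
      = cH * (if κ = a ∧ u a % (Lc : ℤ) = (Lc : ℤ) - 1 then Φ (blk Lc u a + 1) - Φ (blk Lc u a) else 0) := by
  have hLc : 1 ≤ Lc := Nat.one_le_iff_ne_zero.mpr (NeZero.ne Lc)
  have h := sum_tsum_coarseGrad_colH_of_ward hHs hHw (fun y : Site (d + 1) => Φ (y a)) (fun y => hΦ (y a)) κ u
  rw [Finset.sum_eq_single a (fun μ _ hμ => ?_) (fun h => absurd (Finset.mem_univ a) h)] at h
  · have e : ∀ y : Site (d + 1), Φ ((y + unitVec a) a) - Φ (y a) = Φ (y a + 1) - Φ (y a) := fun y => by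
      simp only [Pi.add_apply, unitVec_apply, if_true]
    simp only [e] at h
    rw [h, blk_add_unitVec_apply hLc u κ a]
    by_cases hc : κ = a ∧ u a % (Lc : ℤ) = (Lc : ℤ) - 1
    · rw [if_pos hc, if_pos hc]
    · rw [if_neg hc, if_neg hc, add_zero, sub_self]
  · have e : ∀ y : Site (d + 1), Φ ((y + unitVec μ) a) - Φ (y a) = 0 := fun y => by
      simp only [Pi.add_apply, unitVec_apply, if_neg (Ne.symm hμ), add_zero, sub_self]
    simp only [e, zero_mul, tsum_zero]

/-- NOT IN PRINT; OUR BOOKKEEPING.  **THE SLAB RESPONSE**: the unit multiplier source on all `a`-bonds of the coarse hyperplane `y_a = t` is answered on the field leg `(κ,u)`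
with `cH·𝟙[κ = a ∧ u_a % Lc = Lc − 1 ∧ (blk u)_a = t]` — the EXIT `a`-bonds of the fine slab `⌊u_a∕Lc⌋ = t`, nothing inside the slab, nothing transverse. -/
theorem tsum_slab_colH_of_ward [NeZero Lc]
    (hHs : ∀ (μ κ : Fin (d + 1)) (u : Site (d + 1)), Summable fun y : Site (d + 1) => colH X Lc μ y κ u)
    (hHw : ∀ (y : Site (d + 1)) (κ : Fin (d + 1)) (u : Site (d + 1)),
      ∑ μ, (colH X Lc μ (y - unitVec μ) κ u - colH X Lc μ y κ u) = cH * gaugeWt Lc y κ u)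
    (a : Fin (d + 1)) (t : ℤ) (κ : Fin (d + 1)) (u : Site (d + 1)) :
    ∑' y : Site (d + 1), (if y a = t then (1 : ℝ) else 0) * colH X Lc a y κ u
      = cH * (if κ = a ∧ u a % (Lc : ℤ) = (Lc : ℤ) - 1 ∧ blk Lc u a = t then 1 else 0) := by
  have hΦ : ∀ s : ℤ, |(fun s : ℤ => if t < s then (1 : ℝ) else 0) s| ≤ 1 := fun s => by
    dsimp only; split_ifs <;> simp
  have h := tsum_coordGrad_colH_of_ward hHs hHw a (fun s : ℤ => if t < s then (1 : ℝ) else 0) hΦ κ u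
  have e : ∀ s : ℤ, ((if t < s + 1 then (1 : ℝ) else 0) - (if t < s then (1 : ℝ) else 0)) = if s = t then (1 : ℝ) else 0 := fun s => by
    by_cases h1 : s = t
    · subst h1; simp
    · by_cases h2 : t < s
      · rw [if_pos (by omega), if_pos h2, if_neg h1, sub_self]
      · rw [if_neg (by omega), if_neg h2, if_neg h1, sub_self]
  simp only [e] at h
  rw [h]
  congr 1
  by_cases hc : κ = a ∧ u a % (Lc : ℤ) = (Lc : ℤ) - 1
  · rw [if_pos hc]
    by_cases ht : blk Lc u a = t
    · rw [if_pos ht, if_pos ⟨hc.1, hc.2, ht⟩]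
    · rw [if_neg ht, if_neg (fun hh => ht hh.2.2)]
  · rw [if_neg hc, if_neg (fun hh => hc ⟨hh.1, hh.2.1⟩)]

/-- NOT IN PRINT; OUR BOOKKEEPING.  **THE SLAB SOURCE HAS NO MULTIPLIER-LEG RESPONSE**: `Σ'_y 𝟙[y_a = t]·colM X Lc a y ρ w = 0`. -/
theorem tsum_slab_colM_of_ward
    (hMs : ∀ (μ ρ : Fin (d + 1)) (w : Site (d + 1)), Summable fun y : Site (d + 1) => colM X Lc μ y ρ w)
    (hMw : ∀ (y : Site (d + 1)) (ρ : Fin (d + 1)) (w : Site (d + 1)), ∑ μ, (colM X Lc μ (y - unitVec μ) ρ w - colM X Lc μ y ρ w) = 0)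
    (a : Fin (d + 1)) (t : ℤ) (ρ : Fin (d + 1)) (w : Site (d + 1)) :
    ∑' y : Site (d + 1), (if y a = t then (1 : ℝ) else 0) * colM X Lc a y ρ w = 0 := by
  have hΦ : ∀ y : Site (d + 1), |(fun y : Site (d + 1) => if t < y a then (1 : ℝ) else 0) y| ≤ 1 := fun y => by
    dsimp only; split_ifs <;> simp
  have h := sum_tsum_coarseGrad_colM_of_ward hMs hMw (fun y : Site (d + 1) => if t < y a then (1 : ℝ) else 0) hΦ ρ w
  rw [Finset.sum_eq_single a (fun μ _ hμ => ?_) (fun h => absurd (Finset.mem_univ a) h)] at h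
  · have e : ∀ y : Site (d + 1), ((if t < (y + unitVec a) a then (1 : ℝ) else 0) - (if t < y a then (1 : ℝ) else 0))
        = if y a = t then (1 : ℝ) else 0 := fun y => by
      simp only [Pi.add_apply, unitVec_apply, if_true]
      by_cases h1 : y a = t
      · rw [h1]; simp
      · by_cases h2 : t < y a
        · rw [if_pos (by omega), if_pos h2, if_neg h1, sub_self]
        · rw [if_neg (by omega), if_neg h2, if_neg h1, sub_self]
    simp only [e] at h
    exact h
  · have e : ∀ y : Site (d + 1), ((if t < (y + unitVec μ) a then (1 : ℝ) else 0) - (if t < y a then (1 : ℝ) else 0)) = 0 := fun y => by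
      simp only [Pi.add_apply, unitVec_apply, if_neg (Ne.symm hμ), add_zero, sub_self]
    simp only [e, zero_mul, tsum_zero]

/-- NOT IN PRINT; OUR BOOKKEEPING.  **A BOUNDED SINGLE-COORDINATE SOURCE IS ANSWERED ON EXIT BONDS ONLY, WITH ITS OWN VALUE ON THE SLAB** (direction `a`, bounded
`f : ℤ → ℝ`): `Σ'_y f(y_a)·colH X Lc a y κ u = cH·𝟙[κ = a ∧ u_a % Lc = Lc − 1]·f((blk u)_a)`. -/
theorem tsum_coord_colH_of_ward [NeZero Lc]
    (hHs : ∀ (μ κ : Fin (d + 1)) (u : Site (d + 1)), Summable fun y : Site (d + 1) => colH X Lc μ y κ u)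
    (hHw : ∀ (y : Site (d + 1)) (κ : Fin (d + 1)) (u : Site (d + 1)),
      ∑ μ, (colH X Lc μ (y - unitVec μ) κ u - colH X Lc μ y κ u) = cH * gaugeWt Lc y κ u)
    (a : Fin (d + 1)) (f : ℤ → ℝ) {B : ℝ} (hf : ∀ s, |f s| ≤ B) (κ : Fin (d + 1)) (u : Site (d + 1)) :
    ∑' y : Site (d + 1), f (y a) * colH X Lc a y κ u = cH * (if κ = a ∧ u a % (Lc : ℤ) = (Lc : ℤ) - 1 then f (blk Lc u a) else 0) := by
  classical
  rw [tsum_coord_fibre _ (hHs a κ u) a f hf]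
  simp_rw [tsum_slab_colH_of_ward hHs hHw a _ κ u]
  by_cases hc : κ = a ∧ u a % (Lc : ℤ) = (Lc : ℤ) - 1
  · have e : ∀ t : ℤ, f t * (cH * (if κ = a ∧ u a % (Lc : ℤ) = (Lc : ℤ) - 1 ∧ blk Lc u a = t then 1 else 0))
        = if t = blk Lc u a then cH * f (blk Lc u a) else 0 := fun t => by
      by_cases ht : t = blk Lc u a
      · subst ht; rw [if_pos ⟨hc.1, hc.2, rfl⟩, if_pos rfl]; ring
      · rw [if_neg (fun hh => ht hh.2.2.symm), if_neg ht]; ring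
    rw [tsum_congr e, tsum_ite_eq, if_pos hc]
  · have e : ∀ t : ℤ, f t * (cH * (if κ = a ∧ u a % (Lc : ℤ) = (Lc : ℤ) - 1 ∧ blk Lc u a = t then 1 else 0)) = 0 :=
      fun t => by rw [if_neg (fun hh => hc ⟨hh.1, hh.2.1⟩)]; ring
    rw [tsum_congr e, tsum_zero, if_neg hc, mul_zero]

/-- NOT IN PRINT; OUR BOOKKEEPING.  **NO MULTIPLIER LEGS FOR BOUNDED SINGLE-COORDINATE SOURCES**: `Σ'_y f(y_a)·colM X Lc a y ρ w = 0`. -/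
theorem tsum_coord_colM_of_ward
    (hMs : ∀ (μ ρ : Fin (d + 1)) (w : Site (d + 1)), Summable fun y : Site (d + 1) => colM X Lc μ y ρ w)
    (hMw : ∀ (y : Site (d + 1)) (ρ : Fin (d + 1)) (w : Site (d + 1)), ∑ μ, (colM X Lc μ (y - unitVec μ) ρ w - colM X Lc μ y ρ w) = 0)
    (a : Fin (d + 1)) (f : ℤ → ℝ) {B : ℝ} (hf : ∀ s, |f s| ≤ B) (ρ : Fin (d + 1)) (w : Site (d + 1)) :
    ∑' y : Site (d + 1), f (y a) * colM X Lc a y ρ w = 0 := by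
  rw [tsum_coord_fibre _ (hMs a ρ w) a f hf]
  simp_rw [tsum_slab_colM_of_ward hMs hMw a _ ρ w, mul_zero, tsum_zero]

/-- NOT IN PRINT; OUR BOOKKEEPING.  `HasSum` form of `tsum_coord_colM_of_ward` (the shape gan24-leaf-14's `hasSum_vertexOfM_bond_of_bound` consumes). -/
theorem hasSum_coord_colM_of_ward
    (hMs : ∀ (μ ρ : Fin (d + 1)) (w : Site (d + 1)), Summable fun y : Site (d + 1) => colM X Lc μ y ρ w)
    (hMw : ∀ (y : Site (d + 1)) (ρ : Fin (d + 1)) (w : Site (d + 1)), ∑ μ, (colM X Lc μ (y - unitVec μ) ρ w - colM X Lc μ y ρ w) = 0)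
    (a : Fin (d + 1)) (f : ℤ → ℝ) {B : ℝ} (hf : ∀ s, |f s| ≤ B) (ρ : Fin (d + 1)) (w : Site (d + 1)) :
    HasSum (fun y : Site (d + 1) => f (y a) * colM X Lc a y ρ w) 0 := by
  have h := (summable_bdd_mul (hMs a ρ w) (fun y => hf (y a))).hasSum
  rwa [tsum_coord_colM_of_ward hMs hMw a f hf ρ w] at h

end Ward

/-! ## §3 The letters pass to the units-rescaled kernel `unitK s_f s_m X` -/

section Units

variable {X : MKer (d + 1) (Fib d)} {cH : ℝ}

/-- [folklore] **(W-H) PASSES TO `unitK s_f s_m X` WITH THE CONSTANT `s_f·s_m·cH`** (`colH_unitK`: the `ℋ`-column picks up the factor `s_f·s_m`). -/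
theorem colH_ward_unitK
    (hHw : ∀ (y : Site (d + 1)) (κ : Fin (d + 1)) (u : Site (d + 1)),
      ∑ μ, (colH X Lc μ (y - unitVec μ) κ u - colH X Lc μ y κ u) = cH * gaugeWt Lc y κ u)
    (sf sm : ℝ) (y : Site (d + 1)) (κ : Fin (d + 1)) (u : Site (d + 1)) :
    ∑ μ, (colH (unitK sf sm X) Lc μ (y - unitVec μ) κ u - colH (unitK sf sm X) Lc μ y κ u) = (sf * sm * cH) * gaugeWt Lc y κ u := by
  simp only [colH_unitK, Pi.smul_apply, smul_eq_mul, ← mul_sub, ← Finset.mul_sum, hHw y κ u]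
  ring

/-- [folklore] **(W-M) PASSES TO `unitK s_f s_m X`** (`colM_unitK`: the multiplier column picks up `s_m²`). -/
theorem colM_ward_unitK
    (hMw : ∀ (y : Site (d + 1)) (ρ : Fin (d + 1)) (w : Site (d + 1)), ∑ μ, (colM X Lc μ (y - unitVec μ) ρ w - colM X Lc μ y ρ w) = 0)
    (sf sm : ℝ) (y : Site (d + 1)) (ρ : Fin (d + 1)) (w : Site (d + 1)) :
    ∑ μ, (colM (unitK sf sm X) Lc μ (y - unitVec μ) ρ w - colM (unitK sf sm X) Lc μ y ρ w) = 0 := by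
  have e : ∀ μ : Fin (d + 1), colM (unitK sf sm X) Lc μ (y - unitVec μ) ρ w - colM (unitK sf sm X) Lc μ y ρ w
      = (sm * sm) * (colM X Lc μ (y - unitVec μ) ρ w - colM X Lc μ y ρ w) := fun μ => by
    rw [colM_unitK, colM_unitK]; ring
  simp only [e, ← Finset.mul_sum, hMw y ρ w, mul_zero]

/-- [folklore] **(TG) PASSES TO `unitK s_f s_m X`** (the units are constant diagonal factors). -/
theorem shiftK_unitK_of_shiftK (hXt : ∀ t : Site (d + 1), shiftK (-((Lc : ℤ) • t)) X = X) (sf sm : ℝ) (t : Site (d + 1)) :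
    shiftK (-((Lc : ℤ) • t)) (unitK sf sm X) = unitK sf sm X := by
  show unitK sf sm (shiftK (-((Lc : ℤ) • t)) X) = _
  rw [hXt t]

end Units

/-! ## §4 The instance: the comb-chart resolvents `G′_j = GcombSh Lc j` of the literal of record (III′) -/

section CombStep

variable (Lc) [NeZero Lc]

/-- [folklore] The `ℋ`-column source series of `G′_j` are summable (`CombChartStepJets.decays_GcombSh`). -/
theorem summable_source_colH_GcombSh (j : ℕ) (μ κ : Fin (d + 1)) (u : Site (d + 1)) :
    Summable fun y : Site (d + 1) => colH (GcombSh (d := d) Lc j) Lc μ y κ u := by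
  obtain ⟨δ, C, hδ, _, hK⟩ := decays_GcombSh (d := d) Lc j
  exact summable_colH_of_decays hK hδ μ κ u

/-- [folklore] The multiplier-column source series of `G′_j` are summable. -/
theorem summable_source_colM_GcombSh (j : ℕ) (μ ρ : Fin (d + 1)) (w : Site (d + 1)) :
    Summable fun y : Site (d + 1) => colM (GcombSh (d := d) Lc j) Lc μ y ρ w := by
  obtain ⟨δ, C, hδ, _, hK⟩ := decays_GcombSh (d := d) Lc j
  exact summable_colM_of_decays hK hδ μ ρ w

/-- NOT IN PRINT; OUR BOOKKEEPING.  **(III′) — A BOUNDED SINGLE-COORDINATE SOURCE IS ANSWERED BY `G′_j` ON EXIT BONDS ONLY** (every `j`, direction `a`, bounded `f`):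
`Σ'_y f(y_a)·colH G′_j Lc a y κ u = cH_j·𝟙[κ = a ∧ u_a % Lc = Lc − 1]·f((blk u)_a)`, `cH_j = (stepScale d Lc j·Lc^{d+1})⁻¹` — §2 at an2's `colH_ward_GcombSh`;
the (III′) twin of road-P2's `CoarseGaugeSourceResponse.tsum_coord_colH`, SAME constant. -/
theorem tsum_coord_colH_GcombSh (j : ℕ) (a : Fin (d + 1)) (f : ℤ → ℝ) {B : ℝ} (hf : ∀ s, |f s| ≤ B) (κ : Fin (d + 1)) (u : Site (d + 1)) :
    ∑' y : Site (d + 1), f (y a) * colH (GcombSh (d := d) Lc j) Lc a y κ u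
      = (stepScale d Lc j * (Lc : ℝ) ^ (d + 1))⁻¹ * (if κ = a ∧ u a % (Lc : ℤ) = (Lc : ℤ) - 1 then f (blk Lc u a) else 0) :=
  tsum_coord_colH_of_ward (summable_source_colH_GcombSh Lc j) (fun y κ' u' => colH_ward_GcombSh (d := d) (Lc := Lc) j y κ' u') a f hf κ u

/-- NOT IN PRINT; OUR BOOKKEEPING.  (III′) slab response of `G′_j`: `Σ'_y 𝟙[y_a = t]·colH G′_j Lc a y κ u = cH_j·𝟙[κ = a ∧ u_a % Lc = Lc−1 ∧ (blk u)_a = t]`. -/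
theorem tsum_slab_colH_GcombSh (j : ℕ) (a : Fin (d + 1)) (t : ℤ) (κ : Fin (d + 1)) (u : Site (d + 1)) :
    ∑' y : Site (d + 1), (if y a = t then (1 : ℝ) else 0) * colH (GcombSh (d := d) Lc j) Lc a y κ u
      = (stepScale d Lc j * (Lc : ℝ) ^ (d + 1))⁻¹ * (if κ = a ∧ u a % (Lc : ℤ) = (Lc : ℤ) - 1 ∧ blk Lc u a = t then 1 else 0) :=
  tsum_slab_colH_of_ward (summable_source_colH_GcombSh Lc j) (fun y κ' u' => colH_ward_GcombSh (d := d) (Lc := Lc) j y κ' u') a t κ u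

/-- NOT IN PRINT; OUR BOOKKEEPING.  **(III′) — NO MULTIPLIER LEGS FOR BOUNDED SINGLE-COORDINATE SOURCES**: `Σ'_y f(y_a)·colM G′_j Lc a y ρ w = 0` (every `j`) — §2 at
an2's `colM_GcombSh_ward`; the (III′) twin of road-P2's `tsum_coord_colM`. -/
theorem tsum_coord_colM_GcombSh (j : ℕ) (a : Fin (d + 1)) (f : ℤ → ℝ) {B : ℝ} (hf : ∀ s, |f s| ≤ B) (ρ : Fin (d + 1)) (w : Site (d + 1)) :
    ∑' y : Site (d + 1), f (y a) * colM (GcombSh (d := d) Lc j) Lc a y ρ w = 0 :=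
  tsum_coord_colM_of_ward (summable_source_colM_GcombSh Lc j) (fun y ρ' w' => colM_GcombSh_ward (d := d) (Lc := Lc) j y ρ' w') a f hf ρ w

/-- NOT IN PRINT; OUR BOOKKEEPING.  `HasSum` form of `tsum_coord_colM_GcombSh`. -/
theorem hasSum_coord_colM_GcombSh (j : ℕ) (a : Fin (d + 1)) (f : ℤ → ℝ) {B : ℝ} (hf : ∀ s, |f s| ≤ B) (ρ : Fin (d + 1)) (w : Site (d + 1)) :
    HasSum (fun y : Site (d + 1) => f (y a) * colM (GcombSh (d := d) Lc j) Lc a y ρ w) 0 :=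
  hasSum_coord_colM_of_ward (summable_source_colM_GcombSh Lc j) (fun y ρ' w' => colM_GcombSh_ward (d := d) (Lc := Lc) j y ρ' w') a f hf ρ w

end CombStep

end Summit.QuantumFields.BalabanUV.Beta.GAN24.ColumnResponseOfWardLetters

end
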